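import Summits.BirchSwinnertonDyer.BirchSwinnertonDyer.Theorems.GenusKolyvaginAtTwoGenusPrimitiveSupplyAtTwoArchimedeanKummerCard
import Summits.BirchSwinnertonDyer.BirchSwinnertonDyer.Theorems.GenusKolyvaginAtTwoGenusPrimitiveSupplyAtTwoTwistLocalCondition
import Literature.NumberTheory.GaloisRepresentations.ContinuousH1OrderTwo
import HarnessLib

/-!
# Route `GenusKolyvaginAtTwo`, crux #2 `GenusPrimitiveSupplyAtTwo` (stmt-BirchSwinnertonDyer-22136):
# the real-place inputs of the transversality at `∞` — rational `2`-torsion at a real place with `w(Δ) > 0`,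
# `Γ_{K_w}`-fixedness of `E(K̄_w)[2]`, `2`-divisibility of `E(K̄_w)`, and the «letter–norm» lemma

Width seat `bsd-line-gk2-p5` g9 (cell `bsd-f1-sign2`, SUPPLY lineage, «UP general-K lane»), file 22 of the series (sequel of
`…ArchimedeanKummerCard.lean` p633996). THEOREMS ONLY (no definition, no named fact, no `sorry`, no local instance); helper
`--supports stmt-BirchSwinnertonDyer-22136`; no item is closed; BSD is not proved by any of this.

WHAT (crux memo `Lines/genus-supply-mr-instantiation.md` §6–§7, input (β) = (d)). The transversality at a real place `w₀` of the
transported Kummer line of `E^{(d)}` (`d <_{w₀} 0`) and the Kummer line of `E` (`Δ_E >_{w₀} 0`) — the hypothesis `htr` of file 21's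
`GenusKolyArch.natCard_selmerGroup_twist_shift_of_places_inl_of_parity` — reduces, for the CANONICAL (untwisting) identification, to the
following purely group-theoretic fact about `A = E(K̄_{w₀})` with its involution `σ₀` (§56 `eq_zero_of_eq_sub_of_eq_neg_sub`): if `A` is
`2`-divisible and `A[2]` is `σ₀`-fixed, then an element which is simultaneously a Kummer LETTER `σ₀Q − Q` and a NEGATIVE NORM `−(σ₀R + R)`
vanishes (`R = 2R'`, `Q = 2Q'`: `2Q = N(Q) − x = 2(N(Q') + N(R'))`, so `Q − N(Q') − N(R') ∈ A[2]` is fixed, so `Q` is fixed). This file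
supplies the three inputs at a real place:

* §54 `exists_splitTwoTorsion_completion_of_isReal` — `w(Δ_E) > 0` ⟹ the `2`-division cubic of `E` splits over `K_w` (Kramer's
  `exists_splitTwoTorsion_conj` / `Δ_neg_of_conj_pair` over `ℝ`, pulled back along `K_w ≃+* ℝ`);
* §55 `smul_eq_self_of_add_self_eq_zero_of_splitTwoTorsion` — if the `2`-division cubic of `E` splits over a `K`-field `F`, every point of
  `E(K̄_F)` killed by `2` is `Γ_F`-fixed (`(y + (a₁x + a₃)/2)² = ∏ (x − e_i)`, tree `TwoDescent`); `exists_add_self_eq_localPoints` —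
  `E(K̄_F)` is `2`-divisible (tree `exists_zsmul_eq_geomPoints_baseChange`);
* §56 `eq_zero_of_eq_sub_of_eq_neg_sub` (the letter–norm lemma, abstract), `eq_of_ne_one_of_natCard_le_two` (`|Γ_{K_w}| ≤ 2`).

References: [Kramer1981] §2 Prop. 6 (`N E(ℂ) = 2E(ℝ)`); [MazurRubin2010] Lemma 2.9 («even if `v ∣ ∞`»); [SilvermanAEC2009] X.1.4, III.2.3 (d).
-/

set_option linter.dupNamespace false -- tree convention: `Summit.BirchSwinnertonDyer.BirchSwinnertonDyer.Theorems` (summit = sub-problem)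
set_option autoImplicit false

noncomputable section

open scoped Classical ComplexConjugate

namespace Summit.BirchSwinnertonDyer.BirchSwinnertonDyer.Theorems.GenusKolyArch

open WeierstrassCurve Field NumberField Function
open Literature.NumberTheory.EllipticCurves Literature.NumberTheory.GaloisRepresentations
open Summit.BirchSwinnertonDyer.BirchSwinnertonDyer.Theorems.GenusKolyTwistLocal

universe u

/-! ## §54 Rational `2`-torsion at a real place with `w(Δ) > 0` -/

section Split

variable {K : Type u} [Field K] (W : WeierstrassCurve K) [W.IsElliptic]

/-- **`w(Δ_E) > 0` ⟹ `E[2] ⊂ E(K_w)`**: at a real place `w` with `w(Δ_E) > 0` the `2`-division cubic of `E` has three roots in `K_w`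
(`SplitTwoTorsion` over `K_w`). Over `ℝ` this is Kramer's dichotomy (`exists_splitTwoTorsion_conj`: the roots are `e₁ ∈ ℝ` and either
two more real roots or a conjugate pair, the latter forcing `Δ < 0`, `Δ_neg_of_conj_pair`); pulled back along `K_w ≃+* ℝ`.
[cite: Kramer1981, §2 Prop. 6 (p. 127), the dichotomy on the sign of Δ] -/
theorem exists_splitTwoTorsion_completion_of_isReal {w : InfinitePlace K} (hw : w.IsReal)
    (hΔ : 0 < InfinitePlace.embedding_of_isReal hw W.Δ) :
    ∃ e₁ e₂ e₃ : w.Completion, (W.baseChange w.Completion).toAffine.SplitTwoTorsion e₁ e₂ e₃ := by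
  letI : Algebra K ℝ :=
    ((InfinitePlace.Completion.ringEquivRealOfIsReal hw).toRingHom.comp (algebraMap K w.Completion)).toAlgebra
  let e : w.Completion ≃+* ℝ := InfinitePlace.Completion.ringEquivRealOfIsReal hw
  have hΔ' : 0 < (W.baseChange ℝ).Δ := by rwa [Δ_baseChange_real_eq W hw]
  obtain ⟨c₁, c₂, c₃, h, h₁, hor⟩ :=
    Literature.NumberTheory.EllipticCurves.Kramer1981.exists_splitTwoTorsion_conj (W.baseChange ℝ)
  have h₂₃ : conj c₂ = c₂ ∧ conj c₃ = c₃ := by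
    rcases hor with h' | h'
    · exact h'
    · exact absurd hΔ' (not_lt.mpr
        (Literature.NumberTheory.EllipticCurves.Kramer1981.Δ_neg_of_conj_pair (W.baseChange ℝ) h h₁ h').le)
  obtain ⟨r₁, rfl⟩ := Complex.conj_eq_iff_real.mp h₁
  obtain ⟨r₂, rfl⟩ := Complex.conj_eq_iff_real.mp h₂₃.1
  obtain ⟨r₃, rfl⟩ := Complex.conj_eq_iff_real.mp h₂₃.2
  -- the `b`-coefficients along `K → K_w ≃+* ℝ → ℂ`
  have cb₂ : ((W.baseChange ℝ).baseChange ℂ).b₂ = (((W.baseChange ℝ).b₂ : ℝ) : ℂ) := (W.baseChange ℝ).map_b₂ _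
  have cb₄ : ((W.baseChange ℝ).baseChange ℂ).b₄ = (((W.baseChange ℝ).b₄ : ℝ) : ℂ) := (W.baseChange ℝ).map_b₄ _
  have cb₆ : ((W.baseChange ℝ).baseChange ℂ).b₆ = (((W.baseChange ℝ).b₆ : ℝ) : ℂ) := (W.baseChange ℝ).map_b₆ _
  have kb₂ : (W.baseChange ℝ).b₂ = algebraMap K ℝ W.b₂ := W.map_b₂ _
  have kb₄ : (W.baseChange ℝ).b₄ = algebraMap K ℝ W.b₄ := W.map_b₄ _
  have kb₆ : (W.baseChange ℝ).b₆ = algebraMap K ℝ W.b₆ := W.map_b₆ _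
  have wb₂ : (W.baseChange w.Completion).b₂ = algebraMap K w.Completion W.b₂ := W.map_b₂ _
  have wb₄ : (W.baseChange w.Completion).b₄ = algebraMap K w.Completion W.b₄ := W.map_b₄ _
  have wb₆ : (W.baseChange w.Completion).b₆ = algebraMap K w.Completion W.b₆ := W.map_b₆ _
  have rb₂ : (W.baseChange ℝ).b₂ = e ((W.baseChange w.Completion).b₂) := by rw [kb₂, wb₂]; rfl
  have rb₄ : (W.baseChange ℝ).b₄ = e ((W.baseChange w.Completion).b₄) := by rw [kb₄, wb₄]; rfl
  have rb₆ : (W.baseChange ℝ).b₆ = e ((W.baseChange w.Completion).b₆) := by rw [kb₆, wb₆]; rfl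
  have hb₂ := h.b₂_eq
  have hb₄ := h.b₄_eq
  have hb₆ := h.b₆_eq
  change ((W.baseChange ℝ).baseChange ℂ).b₂ = _ at hb₂
  change ((W.baseChange ℝ).baseChange ℂ).b₄ = _ at hb₄
  change ((W.baseChange ℝ).baseChange ℂ).b₆ = _ at hb₆
  rw [cb₂] at hb₂
  rw [cb₄] at hb₄
  rw [cb₆] at hb₆
  have hb₂' : (W.baseChange ℝ).b₂ = -4 * (r₁ + r₂ + r₃) := by exact_mod_cast hb₂
  have hb₄' : (W.baseChange ℝ).b₄ = 2 * (r₁ * r₂ + r₁ * r₃ + r₂ * r₃) := by exact_mod_cast hb₄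
  have hb₆' : (W.baseChange ℝ).b₆ = -4 * (r₁ * r₂ * r₃) := by exact_mod_cast hb₆
  refine ⟨e.symm r₁, e.symm r₂, e.symm r₃, ⟨?_, ?_, ?_⟩⟩
  · change (W.baseChange w.Completion).b₂ = _
    apply e.injective
    rw [← rb₂, hb₂']
    simp only [map_mul, map_add, map_neg, map_ofNat, RingEquiv.apply_symm_apply]
  · change (W.baseChange w.Completion).b₄ = _
    apply e.injective
    rw [← rb₄, hb₄']
    simp only [map_mul, map_add, map_ofNat, RingEquiv.apply_symm_apply]
  · change (W.baseChange w.Completion).b₆ = _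
    apply e.injective
    rw [← rb₆, hb₆']
    simp only [map_mul, map_neg, map_ofNat, RingEquiv.apply_symm_apply]

end Split

/-! ## §55 `E(K̄_F)[2]` is `Γ_F`-fixed when the `2`-division cubic splits over `F`; `E(K̄_F)` is `2`-divisible -/

section Fixed

variable {K : Type u} [Field K] [NumberField K] (W : WeierstrassCurve K) [W.IsElliptic]
variable (F : Type u) [Field F] [Algebra K F]

omit [W.IsElliptic] in
/-- **If the `2`-division cubic of `E` splits over `F`, every `2`-torsion point of `E(K̄_F)` is `Γ_F`-fixed**: a point `(x, y)` killed by
`2` has `y = −y − a₁x − a₃`, so `(x − e₁)(x − e₂)(x − e₃) = (y + (a₁x + a₃)/2)² = 0` (tree `TwoDescent.sq_eq_mul_mul_of_equation`), i.e.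
`x = e_i ∈ F` and `y = −(a₁x + a₃)/2 ∈ F`. [cite: SilvermanAEC2009, Prop. X.1.4 (hypothesis E[2] ⊆ E(K))] -/
theorem smul_eq_self_of_add_self_eq_zero_of_splitTwoTorsion {e₁ e₂ e₃ : F}
    (h : (W.baseChange F).toAffine.SplitTwoTorsion e₁ e₂ e₃) (σ : absoluteGaloisGroup F)
    (t : localPoints W F) (ht : t + t = 0) : σ • t = t := by
  haveI : NeZero (2 : K) := ⟨two_ne_zero⟩
  haveI : CharZero F := charZero_of_injective_algebraMap (algebraMap K F).injective
  set L := AlgebraicClosure F with hL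
  -- the splitting over `K̄_F`
  have hK : ∀ k : K, algebraMap K L k = algebraMap F L (algebraMap K F k) := fun k ↦
    IsScalarTower.algebraMap_apply K F L k
  have h' : (W.baseChange L).toAffine.SplitTwoTorsion (algebraMap F L e₁) (algebraMap F L e₂) (algebraMap F L e₃) := by
    have hb₂ := h.b₂_eq
    have hb₄ := h.b₄_eq
    have hb₆ := h.b₆_eq
    change (W.baseChange F).b₂ = _ at hb₂
    change (W.baseChange F).b₄ = _ at hb₄
    change (W.baseChange F).b₆ = _ at hb₆
    have fb₂ : (W.baseChange F).b₂ = algebraMap K F W.b₂ := W.map_b₂ _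
    have fb₄ : (W.baseChange F).b₄ = algebraMap K F W.b₄ := W.map_b₄ _
    have fb₆ : (W.baseChange F).b₆ = algebraMap K F W.b₆ := W.map_b₆ _
    have lb₂ : (W.baseChange L).b₂ = algebraMap K L W.b₂ := W.map_b₂ _
    have lb₄ : (W.baseChange L).b₄ = algebraMap K L W.b₄ := W.map_b₄ _
    have lb₆ : (W.baseChange L).b₆ = algebraMap K L W.b₆ := W.map_b₆ _
    rw [fb₂] at hb₂
    rw [fb₄] at hb₄
    rw [fb₆] at hb₆
    refine ⟨?_, ?_, ?_⟩
    · change (W.baseChange L).b₂ = _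
      rw [lb₂, hK, hb₂]
      simp only [map_mul, map_add, map_neg, map_ofNat]
    · change (W.baseChange L).b₄ = _
      rw [lb₄, hK, hb₄]
      simp only [map_mul, map_add, map_ofNat]
    · change (W.baseChange L).b₆ = _
      rw [lb₆, hK, hb₆]
      simp only [map_mul, map_neg, map_ofNat]
  by_cases ht0 : t = 0
  · rw [ht0, smul_zero]
  obtain ⟨x, y, hxy, rfl, hy⟩ :=
    (W.baseChange L).toAffine.exists_eq_some_of_two_torsion (P := show (W.baseChange L).toAffine.Point from t) ht0 ht
  -- `x` is a root, `y = -(a₁ x + a₃)/2`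
  have hsq := WeierstrassCurve.Affine.Point.sq_eq_mul_mul_of_equation h' hxy.1
  have hy2 : y + ((W.baseChange L).a₁ * x + (W.baseChange L).a₃) / 2 = 0 := by
    rw [Affine.negY] at hy
    linear_combination hy / 2
  rw [hy2, zero_pow two_ne_zero] at hsq
  have hx : x = algebraMap F L e₁ ∨ x = algebraMap F L e₂ ∨ x = algebraMap F L e₃ := by
    rcases mul_eq_zero.mp hsq.symm with h12 | h3
    · rcases mul_eq_zero.mp h12 with h1 | h2
      · exact Or.inl (sub_eq_zero.mp h1)
      · exact Or.inr (Or.inl (sub_eq_zero.mp h2))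
    · exact Or.inr (Or.inr (sub_eq_zero.mp h3))
  set σ' : L ≃ₐ[F] L := (show AlgebraicClosure F ≃ₐ[F] AlgebraicClosure F from σ) with hσ'
  have hσx : σ' x = x := by
    rcases hx with hx | hx | hx <;> rw [hx, AlgEquiv.commutes]
  have ha₁ : σ' (W.baseChange L).a₁ = (W.baseChange L).a₁ := by
    change σ' (algebraMap K L W.a₁) = algebraMap K L W.a₁
    rw [hK, AlgEquiv.commutes]
  have ha₃ : σ' (W.baseChange L).a₃ = (W.baseChange L).a₃ := by
    change σ' (algebraMap K L W.a₃) = algebraMap K L W.a₃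
    rw [hK, AlgEquiv.commutes]
  have hyeq : y = -(((W.baseChange L).a₁ * x + (W.baseChange L).a₃) / 2) := eq_neg_of_add_eq_zero_left hy2
  have hσy : σ' y = y := by
    rw [hyeq, map_neg, map_div₀, map_add, map_mul, hσx, ha₁, ha₃, map_ofNat]
  obtain ⟨h'', hsmul⟩ := localPoints_smul_some F W σ hxy
  rw [hsmul]
  change (Affine.Point.some (σ' x) (σ' y) h'' : (W.baseChange L).toAffine.Point) = Affine.Point.some x y hxy
  simp only [hσx, hσy]

omit [NumberField K] in
/-- **`E(K̄_F)` is `2`-divisible** (indeed `n`-divisible; tree `exists_zsmul_eq_geomPoints_baseChange` along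
`baseChangeGeomPointsEquiv`). Silverman, *AEC*, VIII.§2 with III.4.2 (a). [folklore] -/
theorem exists_add_self_eq_localPoints (P : localPoints W F) : ∃ Q : localPoints W F, Q + Q = P := by
  obtain ⟨Q, hQ⟩ := W.exists_zsmul_eq_geomPoints_baseChange F (n := 2) two_ne_zero
    ((W.baseChangeGeomPointsEquiv F).symm P)
  refine ⟨W.baseChangeGeomPointsEquiv F Q, ?_⟩
  rw [← two_zsmul, ← map_zsmul, hQ, AddEquiv.apply_symm_apply]

end Fixed

/-! ## §56 The letter–norm lemma; groups of order `≤ 2` -/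

section Abstract

/-- **The letter–norm lemma.** In an abelian group `A` with an involution `σ` such that `A` is `2`-divisible and every element killed by
`2` is `σ`-fixed, an element which is both a «Kummer letter» `σQ − Q` and a «negative norm» `−(σR + R)` is zero: with `R = 2R'`,
`Q = 2Q'`, `N(X) = σX + X` one has `x = −2N(R')`, `2N(Q') = σQ + Q = 2Q + x`, so `2(Q − N(Q') − N(R')) = 0`; norms being `σ`-fixed
(`σ² = 1`), `Q` is `σ`-fixed and `x = σQ − Q = 0`. This is the archimedean case «even if `v ∣ ∞`» of Mazur–Rubin's Lemma 2.9
(`H¹_f(E) ∩ H¹_f(E^F) = N E(ℂ)/2E(ℝ) = 0`, Kramer: `N E(ℂ) = 2E(ℝ)`). [cite: MazurRubin2010, Lemma 2.9] [cite: Kramer1981, §2 Prop. 6 (p. 127)] -/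
theorem eq_zero_of_eq_sub_of_eq_neg_sub {A : Type*} [AddCommGroup A] (σ : A →+ A) (hσ : ∀ a, σ (σ a) = a)
    (hdiv : ∀ a : A, ∃ b : A, b + b = a) (htors : ∀ t : A, t + t = 0 → σ t = t)
    {x Q R : A} (hQ : x = σ Q - Q) (hR : x = -σ R - R) : x = 0 := by
  obtain ⟨Q', hQ'⟩ := hdiv Q
  obtain ⟨R', hR'⟩ := hdiv R
  have hN : σ (σ Q' + Q') = σ Q' + Q' := by rw [map_add, hσ, add_comm]
  have hM : σ (σ R' + R') = σ R' + R' := by rw [map_add, hσ, add_comm]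
  have h2N : (σ Q' + Q') + (σ Q' + Q') = Q + x + Q := by rw [hQ, ← hQ', map_add]; abel
  have h2M : x = -((σ R' + R') + (σ R' + R')) := by rw [hR, ← hR', map_add]; abel
  set t : A := Q - (σ Q' + Q') - (σ R' + R') with ht
  have ht2 : t + t = 0 := by
    calc t + t = (Q + Q) - ((σ Q' + Q') + (σ Q' + Q')) - ((σ R' + R') + (σ R' + R')) := by rw [ht]; abel
      _ = (Q + Q) - (Q + x + Q) - ((σ R' + R') + (σ R' + R')) := by rw [h2N]
      _ = -x - ((σ R' + R') + (σ R' + R')) := by abel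
      _ = 0 := by rw [h2M]; abel
  have hfix := htors t ht2
  rw [ht, map_sub, map_sub, hN, hM, sub_left_inj, sub_left_inj] at hfix
  rw [hQ, hfix, sub_self]

/-- In a group of order `≤ 2` two non-identity elements coincide (used for `Γ_{K_w}` at a real place `w`: the non-trivial element is
complex conjugation). [folklore] -/
theorem eq_of_ne_one_of_natCard_le_two {G : Type*} [Group G] [Finite G] (hG : Nat.card G ≤ 2) {σ τ : G}
    (hσ : σ ≠ 1) (hτ : τ ≠ 1) : σ = τ := by
  by_contra hne
  haveI := Fintype.ofFinite G
  have h3 : 2 < Fintype.card G := Fintype.two_lt_card_iff.mpr ⟨1, σ, τ, hσ.symm, hτ.symm, hne⟩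
  rw [← Nat.card_eq_fintype_card] at h3
  omega

end Abstract

end Summit.BirchSwinnertonDyer.BirchSwinnertonDyer.Theorems.GenusKolyArch

end
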